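import Summits.QuantumFields.YangMills.Theorems.LuscherReductionTwistedTraceScalingFloorConstants
import Summits.QuantumFields.YangMills.Theorems.TwistedTraceScaling.Negative.ValleyFloorLedger
import HarnessLib

/-!
# R15 (crux `TwistedTraceScaling`, stmt-QuantumFields-20203): the EXPONENT CEILING of lane A's floor route — the sub-solution multiplier `m` of
# `…FloorConstants` / `…FloorSubsolution` sits below the F6 target `Λ_id·e^{−β^{−c}}` for EVERY `c ≥ 1/6`, at every `L`, once the tube radius is
# `≍ β^{−1/3}` and the chart radius obeys `β ρ² ≥ C log β`

Standing disprover `ym-cdisprove-20203-1` (gen 14), sequel to `…Negative.IdealFloorLedger` (R14).  Lane A's generation 10 builds the k = 0 floor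
`VacuumFloorAt L Λ_id tol`, `Λ_id(β) = ((2π²)^{−1}e^{2β}√(π/β)³)^{|E|}·e^{−6·toronZPE L (1/2) 0 0}`, `tol = β^{−c}`, from the POINTWISE SUB-SOLUTION BOUND of
`…FloorConstants` (p594425, part 1) / `…FloorSubsolution` (part 2): at a near-vacuum step `W` with vector parts `≤ τ` and `d_tor W ≤ τ_d`,
`(K_β ψ)(W) ≥ m·ψ(W) − floorCK·floorTail`, with the MULTIPLIER
`m = floorCK L β ρ τ · e^{−riccatiTrialErr} · e^{−γ(2τ_d δ₁ + δ₁²)} · e^{−floorDefect} · √(π/β)^{3|E|} · e^{−6·toronZPE L (1/2) 0 0}`,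
`floorCK L β ρ τ = ((2π²)^{−1}(1+ρ²)^{−2})^{|E|}·e^{2β|E|}·e^{−(β/2)(stepErrUp + chartErr)(ρ, tubeSigma L τ, N)}` (lane B's LOWER prefactor at the tube action level
`tubeSigma L τ = (10τ√N)² + N_P(29376τ³ + 700569τ⁴)`, `N = 3|P|`).  The design scales (HANDOFF-g10): tube `τ = τ_B = β^{−1/3}`, chart `ρ² = C log β/β`.
Any floor on `λ₀` read off this bound through the Rayleigh quotient of `ψ` (plan F5/F6: `Kψ ≥ mψ − r` on the tube, `Kψ ≥ 0` off it) is AT MOST `m`.  This file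
bounds `m` from above by tree facts only:
* §1 `stepRem_ge` (`≥ 66ρ√σ`), `stepErrUp_ge` (`≥ 132ρσ√N`: the `√σ·√N·stepRem` cross term of lane B's step error alone), `tubeSigma_ge` (`≥ 100Nτ²`),
  ★ `floorCK_le`: `floorCK L β ρ τ ≤ (2π²)^{−|E|}·e^{2β|E|}·exp(−66·β·ρ·tubeSigma L τ·√N)`, `floorCK_mul_gauss_le`: `floorCK·√(π/β)^{3|E|} ≤ N_free·exp(−66βρ·tubeSigma·√N)`;
* §2 ★★ `multiplier_lt_idealFloor_target (L) (hc : 1/6 ≤ c) (hA : 0 < A) (hC : 0 < C)` : `∃ β0, ∀ β ≥ β0, ∀ ρ τ X, A·β^{−1/3} ≤ τ → C·log β/β ≤ ρ² → 0 ≤ ρ →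
  0 ≤ X ≤ 1 → floorCK L β ρ τ·X·√(π/β)^{3|E|}·e^{−6Z₀} < Λ_id(β)·e^{−β^{−c}}` — with `X` standing for the product of the remaining factors
  `e^{−riccatiTrialErr}·e^{−γ(…)}·e^{−floorDefect} ∈ (0, 1]` (each exponent is `≥ 0`: `riccatiTrialErr_nonneg`, `γ ≥ 0`, `floorDefect ≥ 0`), i.e. THE MULTIPLIER `m`
  IS BELOW THE F6 TARGET for every `c ≥ 1/6` (equality included), EVERY `L ≥ 1`, every tube radius `τ ≥ A·β^{−1/3}` and every chart radius with `βρ² ≥ C log β`: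
  the step error alone costs `66βρσ√N ≥ 6600·N^{3/2}·A²·√(C log β)·β^{−1/6}`, which beats `β^{−c}` as soon as `log β > (6600N^{3/2}A²√C)^{−2}`;
  `multiplier_lt_idealFloor_target_design` — the instance at the design scales `τ = β^{−1/3}`, `ρ² = C log β/β`.
READING (for lane A's F6 `…FloorAssembly`).  Along the route F4 → F5 → F6 as designed (worst-case action level `tubeSigma L τ_B` on the tube, `ℓ¹` cut-off step),
`VacuumFloorAt L Λ_id (β^{−c})` is reachable ONLY for `c < 1/6`; the exponent `c` of F6 must be typed in `(p, 1/6)` — harmless for the ★★★★ hand-over, whose window is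
`p < 2/51` (R14), but a statement of F6 at any `c ≥ 1/6` cannot be fed by `floor_subsolution_near`.  On paper the balance is sharp for this route: with tube radius
`β^{−a}` the losses are `β^{1/2−2a}` (step error at the tube action level), `β^{a−1/2}` (cut-off cross term `2γτ_dδ₁`), `β^{2a−1}` (localisation), `β^{1−4a}`
(quartic tube defect), minimised at `a = 1/3` with value `β^{−1/6}`; using the trial state's own action level (`σ ≍ 1/β`) would give `1/5`, averaging the linear
cut-off term `1/4`, both `1/3` = the true order of the toron deficit (R14 docstring; Lüscher 1983 §3).  NO KILL of the crux, of F6 for `c < 1/6`, or of F7 on the ledger.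
HONEST FRAMING: fixed-lattice `SU(2)` bookkeeping about the explicit constants of a stub lane (S-BASE C3d FLOOR) of a child of the CONDITIONAL reduction route
(femto rung R2b1); not `¬TwistedTraceScaling`, not infinite volume, not a gap, not Clay.  Sorry-free, no new definition; axioms ⊆ {propext, Classical.choice, Quot.sound}.

## References
* M. Lüscher, Nucl. Phys. B219 (1983) 233, §3. [Luscher1983]
-/

set_option autoImplicit false

noncomputable section

open Real
open Literature.MathematicalPhysics.QuantumFieldTheory
open Literature.MathematicalPhysics.QuantumLattice
open Summit.QuantumFields.YangMills.Theorems.FemtoTransferGap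
open Summit.QuantumFields.YangMills.Theorems.FemtoTransferGap.TwoLattice
open Summit.QuantumFields.YangMills.Theorems.FemtoTransferGap.TwoLattice.Toron
open Summit.QuantumFields.YangMills.Theorems.FemtoTransferGap.TwoLattice.Cov

namespace Summit.QuantumFields.YangMills.Theorems.TwistedTraceScaling.Negative.R15

/-! ## §1 Lower bounds on the route's error functions; the prefactor `floorCK` from above -/

/-- `stepRem ρ σ ≥ 66ρ√σ` (`ρ ≥ 0`). [folklore] -/
theorem stepRem_ge (ρ σ : ℝ) : 66 * ρ * Real.sqrt σ ≤ stepRem ρ σ := by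
  unfold stepRem; nlinarith [sq_nonneg ρ]

/-- **The cross term of lane B's step error**: `stepErrUp ρ σ N ≥ 2√σ·√N·stepRem ≥ 132·ρ·σ·√N` (`ρ, σ ≥ 0`; any `N`, `√N` being `0` for `N < 0`). [cite: Luscher1983, §3] -/
theorem stepErrUp_ge {ρ σ N : ℝ} (hρ : 0 ≤ ρ) (hσ : 0 ≤ σ) : 132 * ρ * σ * Real.sqrt N ≤ stepErrUp ρ σ N := by
  have hs0 : 0 ≤ Real.sqrt σ := Real.sqrt_nonneg σ
  have hN0 : 0 ≤ Real.sqrt N := Real.sqrt_nonneg N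
  have hrem : 66 * ρ * Real.sqrt σ ≤ stepRem ρ σ := stepRem_ge ρ σ
  have hrem0 : 0 ≤ stepRem ρ σ := stepRem_nonneg' σ hρ
  have hss : Real.sqrt σ * Real.sqrt σ = σ := Real.mul_self_sqrt hσ
  have hlo0 : 0 ≤ stepErrLo ρ σ N := stepErrLo_nonneg' σ N hρ
  -- `stepErrLo ≥ 2√σ·(√N·stepRem) ≥ 2√σ·√N·66ρ√σ = 132ρσ√N`
  have h1 : 2 * Real.sqrt σ * (Real.sqrt N * stepRem ρ σ) ≤ stepErrLo ρ σ N := by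
    unfold stepErrLo
    have h0 : 0 ≤ Real.sqrt N * stepRem ρ σ := mul_nonneg hN0 hrem0
    have : 2 * Real.sqrt σ ≤ 2 * (Real.sqrt σ + 10 * ρ * Real.sqrt N) := by nlinarith [mul_nonneg hρ hN0]
    exact mul_le_mul_of_nonneg_right this h0
  have h2 : 132 * ρ * σ * Real.sqrt N ≤ 2 * Real.sqrt σ * (Real.sqrt N * stepRem ρ σ) := by
    have h3 := mul_le_mul_of_nonneg_left hrem (mul_nonneg (mul_nonneg (by norm_num : (0:ℝ) ≤ 2) hs0) hN0)
    calc 132 * ρ * σ * Real.sqrt N = 2 * Real.sqrt σ * Real.sqrt N * (66 * ρ * Real.sqrt σ) := by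
            linear_combination (-(132 * ρ * Real.sqrt N)) * hss
      _ ≤ 2 * Real.sqrt σ * Real.sqrt N * stepRem ρ σ := h3
      _ = _ := by ring
  have h4 : stepErrLo ρ σ N ≤ stepErrUp ρ σ N := by
    unfold stepErrUp
    have h5 : 0 ≤ (Real.sqrt N * stepRem ρ σ) ^ 2 := sq_nonneg _
    have h6 : 0 ≤ (Real.sqrt σ + 10 * ρ * Real.sqrt N + Real.sqrt N * stepRem ρ σ) ^ 4 := by positivity
    linarith
  linarith

/-- `tubeSigma L τ ≥ 0` for `τ ≥ 0`. [folklore] -/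
theorem tubeSigma_nonneg (L : ℕ) [NeZero L] {τ : ℝ} (hτ : 0 ≤ τ) : 0 ≤ tubeSigma L τ := by
  unfold tubeSigma; positivity

/-- **The tube action level is at least its Gaussian part**: `tubeSigma L τ ≥ (10τ√N)² = 100·N·τ²` (`τ ≥ 0`). [cite: Luscher1983, §3] -/
theorem tubeSigma_ge (L : ℕ) [NeZero L] {τ : ℝ} (hτ : 0 ≤ τ) :
    100 * (Fintype.card (Plaquette 3 L × Fin 3) : ℝ) * τ ^ 2 ≤ tubeSigma L τ := by
  unfold tubeSigma
  have hN : (0 : ℝ) ≤ (Fintype.card (Plaquette 3 L × Fin 3) : ℝ) := by positivity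
  have h1 : (10 * τ * Real.sqrt (Fintype.card (Plaquette 3 L × Fin 3) : ℝ)) ^ 2 =
      100 * (Fintype.card (Plaquette 3 L × Fin 3) : ℝ) * τ ^ 2 := by
    rw [mul_pow, mul_pow, Real.sq_sqrt hN]; ring
  have h2 : 0 ≤ (Fintype.card (Plaquette 3 L) : ℝ) * (29376 * τ ^ 3 + 700569 * τ ^ 4) := by positivity
  linarith

/-- ★ **Lane B's LOWER prefactor at the tube action level, from above**: for `β, ρ, τ ≥ 0`,
`floorCK L β ρ τ ≤ (2π²)^{−|E|}·e^{2β|E|}·exp(−66·β·ρ·tubeSigma L τ·√N)` — drop `(1+ρ²)^{−2} ≤ 1`, `chartErr ≥ 0` and all of `stepErrUp` but its cross term.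
[cite: Luscher1983, §3] -/
theorem floorCK_le (L : ℕ) [NeZero L] {β ρ τ : ℝ} (hβ : 0 ≤ β) (hρ : 0 ≤ ρ) (hτ : 0 ≤ τ) :
    floorCK L β ρ τ ≤ ((2 * π ^ 2)⁻¹) ^ Fintype.card (Edge 3 L) * Real.exp (2 * β) ^ Fintype.card (Edge 3 L) *
      Real.exp (-(66 * β * ρ * tubeSigma L τ * Real.sqrt (Fintype.card (Plaquette 3 L × Fin 3) : ℝ))) := by
  have hσ : 0 ≤ tubeSigma L τ := tubeSigma_nonneg L hτ
  have h1 : ((2 * π ^ 2)⁻¹ * ((1 + ρ ^ 2)⁻¹) ^ 2) ^ Fintype.card (Edge 3 L) ≤ ((2 * π ^ 2)⁻¹) ^ Fintype.card (Edge 3 L) := by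
    apply pow_le_pow_left₀ (by positivity)
    have h0 : 0 ≤ (1 + ρ ^ 2)⁻¹ := by positivity
    have h : (1 + ρ ^ 2)⁻¹ ≤ 1 := inv_le_one_of_one_le₀ (by nlinarith [sq_nonneg ρ])
    have h' : ((1 + ρ ^ 2)⁻¹) ^ 2 ≤ 1 := by nlinarith
    calc (2 * π ^ 2)⁻¹ * ((1 + ρ ^ 2)⁻¹) ^ 2 ≤ (2 * π ^ 2)⁻¹ * 1 := mul_le_mul_of_nonneg_left h' (by positivity)
      _ = _ := mul_one _
  have h2 : Real.exp (-(β / 2) * (stepErrUp ρ (tubeSigma L τ) (Fintype.card (Plaquette 3 L × Fin 3) : ℝ) +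
        chartErr ρ (tubeSigma L τ) (Fintype.card (Plaquette 3 L × Fin 3) : ℝ))) ≤
      Real.exp (-(66 * β * ρ * tubeSigma L τ * Real.sqrt (Fintype.card (Plaquette 3 L × Fin 3) : ℝ))) := by
    rw [Real.exp_le_exp]
    have hs := stepErrUp_ge (N := (Fintype.card (Plaquette 3 L × Fin 3) : ℝ)) hρ hσ
    have hc := chartErr_nonneg' (tubeSigma L τ) (Fintype.card (Plaquette 3 L × Fin 3) : ℝ) hρ
    have hb : (0 : ℝ) ≤ β / 2 := by positivity
    have h3 := mul_le_mul_of_nonneg_left hs hb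
    have h4 := mul_nonneg hb hc
    nlinarith
  unfold floorCK
  exact mul_le_mul (mul_le_mul_of_nonneg_right h1 (by positivity)) h2 (Real.exp_pos _).le (by positivity)

/-- `floorCK·√(π/β)^{3|E|} ≤ N_free(β)·exp(−66βρ·tubeSigma·√N)`, `N_free(β) = (e^{2β}√(π/β)³/(2π²))^{|E|}` (the free Schur–Gauss ceiling of R13). [cite: Luscher1983, §3] -/
theorem floorCK_mul_gauss_le (L : ℕ) [NeZero L] {β ρ τ : ℝ} (hβ : 0 ≤ β) (hρ : 0 ≤ ρ) (hτ : 0 ≤ τ) :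
    floorCK L β ρ τ * (Real.sqrt (π / β) ^ 3) ^ Fintype.card (Edge 3 L) ≤
      (Real.exp (2 * β) * Real.sqrt (π / β) ^ 3 / (2 * π ^ 2)) ^ Fintype.card (Edge 3 L) *
        Real.exp (-(66 * β * ρ * tubeSigma L τ * Real.sqrt (Fintype.card (Plaquette 3 L × Fin 3) : ℝ))) := by
  have h := floorCK_le L hβ hρ hτ
  have hg : 0 ≤ (Real.sqrt (π / β) ^ 3) ^ Fintype.card (Edge 3 L) := by positivity
  calc floorCK L β ρ τ * (Real.sqrt (π / β) ^ 3) ^ Fintype.card (Edge 3 L)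
      ≤ ((2 * π ^ 2)⁻¹) ^ Fintype.card (Edge 3 L) * Real.exp (2 * β) ^ Fintype.card (Edge 3 L) *
          Real.exp (-(66 * β * ρ * tubeSigma L τ * Real.sqrt (Fintype.card (Plaquette 3 L × Fin 3) : ℝ))) *
          (Real.sqrt (π / β) ^ 3) ^ Fintype.card (Edge 3 L) := mul_le_mul_of_nonneg_right h hg
    _ = _ := by rw [div_pow, mul_pow, inv_pow]; ring

/-! ## §2 ★★ The multiplier is below the F6 target for every `c ≥ 1/6` -/

/-- **Exponent bookkeeping** (`β ≥ 1`, `A, C > 0`): if `A·β^{−1/3} ≤ τ`, `C·log β/β ≤ ρ²`, `ρ ≥ 0`, then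
`6600·N·√N·A²·√C·√(log β)·β^{−1/6} ≤ 66·β·ρ·tubeSigma L τ·√N`. [folklore] -/
theorem stepLoss_ge (L : ℕ) [NeZero L] {β ρ τ A C : ℝ} (hβ : 1 ≤ β) (hA : 0 < A) (hC : 0 < C) (hτ : A * β ^ (-(1 / 3 : ℝ)) ≤ τ)
    (hρ2 : C * Real.log β / β ≤ ρ ^ 2) (hρ : 0 ≤ ρ) :
    6600 * (Fintype.card (Plaquette 3 L × Fin 3) : ℝ) * Real.sqrt (Fintype.card (Plaquette 3 L × Fin 3) : ℝ) * A ^ 2 * Real.sqrt C *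
        Real.sqrt (Real.log β) * β ^ (-(1 / 6 : ℝ)) ≤
      66 * β * ρ * tubeSigma L τ * Real.sqrt (Fintype.card (Plaquette 3 L × Fin 3) : ℝ) := by
  set N : ℝ := (Fintype.card (Plaquette 3 L × Fin 3) : ℝ) with hNdef
  have hN : 0 ≤ N := by positivity
  have hβ0 : 0 < β := by linarith
  have hlog : 0 ≤ Real.log β := Real.log_nonneg hβ
  have ht0 : 0 < β ^ (-(1 / 3 : ℝ)) := Real.rpow_pos_of_pos hβ0 _
  have hτ0 : 0 ≤ τ := le_trans (by positivity) hτ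
  -- `τ² ≥ A²·β^{−2/3}`
  have hτ2 : (A * β ^ (-(1 / 3 : ℝ))) ^ 2 ≤ τ ^ 2 := pow_le_pow_left₀ (by positivity) hτ 2
  have hpow23 : (β ^ (-(1 / 3 : ℝ))) ^ 2 = β ^ (-(2 / 3 : ℝ)) := by
    rw [← Real.rpow_natCast, ← Real.rpow_mul hβ0.le]; norm_num
  -- `ρ ≥ √C·√(log β)·β^{−1/2}`
  have hhalf : (β ^ (-(1 / 2 : ℝ))) ^ 2 = β⁻¹ := by
    rw [← Real.rpow_natCast, ← Real.rpow_mul hβ0.le, ← Real.rpow_neg_one]; norm_num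
  have hρlow : Real.sqrt C * Real.sqrt (Real.log β) * β ^ (-(1 / 2 : ℝ)) ≤ ρ := by
    have h0 : 0 ≤ Real.sqrt C * Real.sqrt (Real.log β) * β ^ (-(1 / 2 : ℝ)) := by positivity
    have hsq : (Real.sqrt C * Real.sqrt (Real.log β) * β ^ (-(1 / 2 : ℝ))) ^ 2 = C * Real.log β / β := by
      rw [mul_pow, mul_pow, Real.sq_sqrt hC.le, Real.sq_sqrt hlog, hhalf, div_eq_mul_inv]
    calc Real.sqrt C * Real.sqrt (Real.log β) * β ^ (-(1 / 2 : ℝ))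
        = Real.sqrt ((Real.sqrt C * Real.sqrt (Real.log β) * β ^ (-(1 / 2 : ℝ))) ^ 2) := (Real.sqrt_sq h0).symm
      _ ≤ Real.sqrt (ρ ^ 2) := Real.sqrt_le_sqrt (by rw [hsq]; exact hρ2)
      _ = ρ := Real.sqrt_sq hρ
  -- `β·β^{−1/2}·β^{−2/3} = β^{−1/6}`
  have hexp : β * β ^ (-(1 / 2 : ℝ)) * β ^ (-(2 / 3 : ℝ)) = β ^ (-(1 / 6 : ℝ)) := by
    conv_lhs => rw [show (β : ℝ) = β ^ (1 : ℝ) by rw [Real.rpow_one]]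
    rw [show (β ^ (1 : ℝ)) ^ (-(1 / 2 : ℝ)) = β ^ (-(1 / 2 : ℝ)) by rw [Real.rpow_one],
      show (β ^ (1 : ℝ)) ^ (-(2 / 3 : ℝ)) = β ^ (-(2 / 3 : ℝ)) by rw [Real.rpow_one],
      ← Real.rpow_add hβ0, ← Real.rpow_add hβ0]
    norm_num
  -- the tube level
  have hσ : 100 * N * τ ^ 2 ≤ tubeSigma L τ := tubeSigma_ge L hτ0
  -- assemble: `66βρσ√N ≥ 66β·ρ·(100Nτ²)·√N ≥ 6600 N√N · β · (√C√log β β^{−1/2}) · (A² β^{−2/3})`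
  have h1 : 66 * β * ρ * (100 * N * τ ^ 2) * Real.sqrt N ≤ 66 * β * ρ * tubeSigma L τ * Real.sqrt N := by
    have h0 : 0 ≤ 66 * β * ρ := by positivity
    exact mul_le_mul_of_nonneg_right (mul_le_mul_of_nonneg_left hσ h0) (Real.sqrt_nonneg _)
  have h2 : 66 * β * (Real.sqrt C * Real.sqrt (Real.log β) * β ^ (-(1 / 2 : ℝ))) * (100 * N * (A * β ^ (-(1 / 3 : ℝ))) ^ 2) * Real.sqrt N ≤
      66 * β * ρ * (100 * N * τ ^ 2) * Real.sqrt N := by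
    have ha : 66 * β * (Real.sqrt C * Real.sqrt (Real.log β) * β ^ (-(1 / 2 : ℝ))) ≤ 66 * β * ρ :=
      mul_le_mul_of_nonneg_left hρlow (by positivity)
    have hb : 100 * N * (A * β ^ (-(1 / 3 : ℝ))) ^ 2 ≤ 100 * N * τ ^ 2 := mul_le_mul_of_nonneg_left hτ2 (by positivity)
    have hb0 : 0 ≤ 100 * N * (A * β ^ (-(1 / 3 : ℝ))) ^ 2 := by positivity
    exact mul_le_mul_of_nonneg_right (mul_le_mul ha hb hb0 (by positivity)) (Real.sqrt_nonneg _)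
  have h3 : 66 * β * (Real.sqrt C * Real.sqrt (Real.log β) * β ^ (-(1 / 2 : ℝ))) * (100 * N * (A * β ^ (-(1 / 3 : ℝ))) ^ 2) * Real.sqrt N =
      6600 * N * Real.sqrt N * A ^ 2 * Real.sqrt C * Real.sqrt (Real.log β) * β ^ (-(1 / 6 : ℝ)) := by
    rw [mul_pow, hpow23, ← hexp]; ring
  linarith [h1, h2, h3.symm.le]

/-- ★★ **THE ROUTE'S EXPONENT CEILING** (every `L ≥ 1`; `c ≥ 1/6`, `A, C > 0`): eventually in `β`, for every tube radius `τ ≥ A·β^{−1/3}`, every chart radius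
with `C·log β/β ≤ ρ²` (`ρ ≥ 0`) and every `X ∈ [0, 1]` (the product `e^{−riccatiTrialErr}·e^{−γ(2τ_dδ₁ + δ₁²)}·e^{−floorDefect}` of the remaining factors of the
multiplier), `floorCK L β ρ τ · X · √(π/β)^{3|E|} · e^{−6·toronZPE L (1/2) 0 0} < Λ_id(β)·e^{−β^{−c}}`: the sub-solution multiplier of `…FloorConstants` /
`…FloorSubsolution` is BELOW the target of `VacuumFloorAt L Λ_id (β^{−c})`.  The step error alone costs `66βρσ√N ≥ 6600N^{3/2}A²√(C log β)·β^{−1/6} > β^{−1/6} ≥ β^{−c}`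
once `log β > (6600N^{3/2}A²√C)^{−2}`. [cite: Luscher1983, §3] -/
theorem multiplier_lt_idealFloor_target (L : ℕ) [NeZero L] {c A C : ℝ} (hc : 1 / 6 ≤ c) (hA : 0 < A) (hC : 0 < C) :
    ∃ β0 : ℝ, ∀ β : ℝ, β0 ≤ β → ∀ ρ τ X : ℝ, A * β ^ (-(1 / 3 : ℝ)) ≤ τ → C * Real.log β / β ≤ ρ ^ 2 → 0 ≤ ρ → 0 ≤ X → X ≤ 1 →
      floorCK L β ρ τ * X * (Real.sqrt (π / β) ^ 3) ^ Fintype.card (Edge 3 L) * Real.exp (-(6 * toronZPE L (1 / 2) 0 0)) <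
        (Real.exp (2 * β) * Real.sqrt (π / β) ^ 3 / (2 * π ^ 2)) ^ Fintype.card (Edge 3 L) *
          Real.exp (-(6 * toronZPE L (1 / 2) 0 0)) * Real.exp (-(β ^ (-c))) := by
  set N : ℝ := (Fintype.card (Plaquette 3 L × Fin 3) : ℝ) with hNdef
  obtain ⟨hN1, -, -⟩ := R13.one_le_cards L
  have hN1' : 1 ≤ N := hN1
  set K : ℝ := 6600 * N * Real.sqrt N * A ^ 2 * Real.sqrt C with hKdef
  have hK : 0 < K := by positivity
  refine ⟨Real.exp (1 / K ^ 2 + 1), fun β hβ ρ τ X hτ hρ2 hρ hX0 hX1 => ?_⟩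
  have hβ1 : 1 ≤ β := by
    have h1 := Real.add_one_le_exp (1 / K ^ 2 + 1)
    have h2 : 0 ≤ 1 / K ^ 2 := by positivity
    linarith
  have hβ0 : 0 < β := by linarith
  have hlog : 1 / K ^ 2 + 1 ≤ Real.log β := by
    have := Real.log_le_log (Real.exp_pos _) hβ
    rwa [Real.log_exp] at this
  have ht0 : 0 < β ^ (-(1 / 3 : ℝ)) := Real.rpow_pos_of_pos hβ0 _
  have hτ0 : 0 ≤ τ := le_trans (by positivity) hτ
  -- `K·√(log β) > 1`
  have hK1 : 1 < K * Real.sqrt (Real.log β) := by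
    have hs : 1 / K ^ 2 + 1 ≤ Real.sqrt (Real.log β) ^ 2 := by
      rw [Real.sq_sqrt (Real.log_nonneg hβ1)]; exact hlog
    have h0 : 0 ≤ K * Real.sqrt (Real.log β) := by positivity
    by_contra h
    push Not at h
    have h2 : (K * Real.sqrt (Real.log β)) ^ 2 ≤ 1 := pow_le_one₀ h0 h
    have h3 : (K * Real.sqrt (Real.log β)) ^ 2 = K ^ 2 * Real.sqrt (Real.log β) ^ 2 := by ring
    have h4 : K ^ 2 * (1 / K ^ 2 + 1) ≤ K ^ 2 * Real.sqrt (Real.log β) ^ 2 := mul_le_mul_of_nonneg_left hs (by positivity)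
    have h5 : K ^ 2 * (1 / K ^ 2 + 1) = 1 + K ^ 2 := by field_simp
    nlinarith [sq_nonneg K]
  -- the loss beats `β^{−c}`
  have hstep := stepLoss_ge L hβ1 hA hC hτ hρ2 hρ
  have h16 : 0 < β ^ (-(1 / 6 : ℝ)) := Real.rpow_pos_of_pos hβ0 _
  have hc6 : β ^ (-c) ≤ β ^ (-(1 / 6 : ℝ)) := Real.rpow_le_rpow_of_exponent_le hβ1 (by linarith)
  have hloss : β ^ (-c) < 66 * β * ρ * tubeSigma L τ * Real.sqrt N := by
    have h1 : β ^ (-(1 / 6 : ℝ)) < K * Real.sqrt (Real.log β) * β ^ (-(1 / 6 : ℝ)) := by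
      have := mul_lt_mul_of_pos_right hK1 h16
      rwa [one_mul] at this
    have h2 : K * Real.sqrt (Real.log β) * β ^ (-(1 / 6 : ℝ)) =
        6600 * N * Real.sqrt N * A ^ 2 * Real.sqrt C * Real.sqrt (Real.log β) * β ^ (-(1 / 6 : ℝ)) := by rw [hKdef]
    linarith
  have hexp : Real.exp (-(66 * β * ρ * tubeSigma L τ * Real.sqrt N)) < Real.exp (-(β ^ (-c))) := Real.exp_lt_exp.2 (by linarith)
  -- assemble
  set G : ℝ := (Real.sqrt (π / β) ^ 3) ^ Fintype.card (Edge 3 L) with hGdef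
  set Nf : ℝ := (Real.exp (2 * β) * Real.sqrt (π / β) ^ 3 / (2 * π ^ 2)) ^ Fintype.card (Edge 3 L) with hNfdef
  set Z : ℝ := Real.exp (-(6 * toronZPE L (1 / 2) 0 0)) with hZdef
  have hNf : 0 < Nf := by positivity
  have hZ : 0 < Z := Real.exp_pos _
  have hG : 0 ≤ G := by positivity
  have hCK : 0 ≤ floorCK L β ρ τ := floorCK_nonneg β ρ τ
  have hm1 : floorCK L β ρ τ * X * G * Z ≤ floorCK L β ρ τ * G * Z := by
    have : floorCK L β ρ τ * X ≤ floorCK L β ρ τ := by nlinarith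
    exact mul_le_mul_of_nonneg_right (mul_le_mul_of_nonneg_right this hG) hZ.le
  have hm2 : floorCK L β ρ τ * G ≤ Nf * Real.exp (-(66 * β * ρ * tubeSigma L τ * Real.sqrt N)) := floorCK_mul_gauss_le L hβ0.le hρ hτ0
  have hm3 : Nf * Real.exp (-(66 * β * ρ * tubeSigma L τ * Real.sqrt N)) < Nf * Real.exp (-(β ^ (-c))) := mul_lt_mul_of_pos_left hexp hNf
  calc floorCK L β ρ τ * X * G * Z ≤ floorCK L β ρ τ * G * Z := hm1
    _ ≤ Nf * Real.exp (-(66 * β * ρ * tubeSigma L τ * Real.sqrt N)) * Z := mul_le_mul_of_nonneg_right hm2 hZ.le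
    _ < Nf * Real.exp (-(β ^ (-c))) * Z := mul_lt_mul_of_pos_right hm3 hZ
    _ = Nf * Z * Real.exp (-(β ^ (-c))) := by ring

/-- **At the design scales** `τ = β^{−1/3}`, `ρ = √(C log β/β)` (HANDOFF-g10 F6): for every `c ≥ 1/6`, eventually the multiplier (with any remaining factor
`X ∈ [0,1]`) is below `Λ_id·e^{−β^{−c}}`. [cite: Luscher1983, §3] -/
theorem multiplier_lt_idealFloor_target_design (L : ℕ) [NeZero L] {c C : ℝ} (hc : 1 / 6 ≤ c) (hC : 0 < C) :
    ∃ β0 : ℝ, ∀ β : ℝ, β0 ≤ β → ∀ X : ℝ, 0 ≤ X → X ≤ 1 →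
      floorCK L β (Real.sqrt (C * Real.log β / β)) (β ^ (-(1 / 3 : ℝ))) * X * (Real.sqrt (π / β) ^ 3) ^ Fintype.card (Edge 3 L) *
          Real.exp (-(6 * toronZPE L (1 / 2) 0 0)) <
        (Real.exp (2 * β) * Real.sqrt (π / β) ^ 3 / (2 * π ^ 2)) ^ Fintype.card (Edge 3 L) *
          Real.exp (-(6 * toronZPE L (1 / 2) 0 0)) * Real.exp (-(β ^ (-c))) := by
  obtain ⟨β0, hβ0⟩ := multiplier_lt_idealFloor_target L hc one_pos hC
  refine ⟨max β0 1, fun β hβ X hX0 hX1 => ?_⟩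
  have hβ1 : 1 ≤ β := (le_max_right _ _).trans hβ
  have hβpos : 0 < β := by linarith
  have hlog : 0 ≤ C * Real.log β / β := div_nonneg (mul_nonneg hC.le (Real.log_nonneg hβ1)) hβpos.le
  exact hβ0 β ((le_max_left _ _).trans hβ) _ _ X (by rw [one_mul]) (by rw [Real.sq_sqrt hlog]) (Real.sqrt_nonneg _) hX0 hX1

end Summit.QuantumFields.YangMills.Theorems.TwistedTraceScaling.Negative.R15

end
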